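import Summits.BirchSwinnertonDyer.BirchSwinnertonDyer.Theorems.PrintX11aMuCosetDoor
import Summits.BirchSwinnertonDyer.Rank1Residual.X11a.ChaRecords1
import HarnessLib

/-!
# Class X11a, NON-surjective leaf, NON-SPLIT UNIT-VALUE sub-locus @ 5: per-pair bookings through the p3
# road's unit-value door — file 2 of 5: `118080de1`, `118080df1`, `154880h1`
# (cell `bsd-print-x11a`, seat p3 g2; `--supports stmt-BirchSwinnertonDyer-20614 --as helper`)

HONEST FRAMING (cells `b2b-bsdres` / `bsd-print-x11a`, verbatim): the goal is to DELETE the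
COMBINATION-SHAPED residual classes of the Birch–Swinnerton-Dyer formula for ALL analytic-rank
`≤ 1` elliptic curves over `ℚ` — "full BSD formula for every rank `≤ 1` curve in class `C`"
assembled STRICTLY from published theorems — so that the rank-`≤ 1` remainder becomes exactly the
CONSTRUCTION-SHAPED classes, which are TYPED (missing-input `Prop`s), NOT attempted. This is not
"finishing BSD". PER PAIR (E1 currency): theorems only, no definition, no named fact; nothing is booked
by this file and no class label changes (referee / planner). The CLASS-level child `UpperNonSurjFive`
(item 20614) of crux `X11aNonSurjEulerHalf` stays OPEN (Greenberg's μ-conjecture on the non-surjective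
X11a locus, barrier B3).

## What

The 14 NON-split non-surjective X11a pairs at `p = 5` of the census (ty3 `RecordsLeafNonSurjN500000Part1–2`,
`N < 5·10⁵`) with `L(E,1)/Ω_E` a `5`-adic UNIT that were not yet booked through the unit-value door
(`X11a/ChaRecords1–6.lean` booked 12; the 6 `5Ns` pairs among them are ALSO decided flag-free by the exact
Shapiro `5`-descent records `X11b/ShapiroPairsRankZero.lean`, 4 of the `5S4` pairs by the GRH-flagged
descents of `X11a/DescentPairs.lean`; here a descent-free, GRH-free second road). Per pair:
`mub5_u<label> : Typed.MissingUpperBoundAt W 5` by p3 g1's class-free unit-value door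
`X11a.ChaRecords.mub_of_unitValue_nonsplit` (the LEVEL-1 μ-witness: the constant term `2·ϖ·[0]⁺_f =
2·L(E,1)/Ω_E` of THE non-split Mazur–Tate–Teitelbaum function is a unit ⟹ analytic μ = 0 ⟹ μ-transfer
without big image ⟹ Kato ⟹ rank-0 engine), modulo its THIRTEEN named facts (Greenberg–Stevens vacuous
at a non-split prime, discharged by `RankZeroHeightFree.greenberg_stevens_of_not_split`); DISPLAYED `r_an = 0`
(`hr`), the image bit (`hnsj`), `L(E,1)/Ω_E = t` (`ht`, the value displayed; `ord₅ t = 0` decided in the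
kernel); KERNEL: Kraus minimality, `Mult`, `Irr` (Frobenius witness), non-split (node tangent). And
`bsdp5_u<label> : BSDp W 5` with the displayed unit `#Ш_an` (`X11a.bsdp_of_upper_of_unit_of_analyticRank_eq_zero`).
With these, EVERY non-surjective X11a pair of the census at `p = 5` (56) has a kernel μ-certificate booking
of the Euler half (26 unit-value + 30 coset). beyond-print theorem: no.

References: [MazurTateTeitelbaum1986Invent] §I.10, §I.14; [Kato2004Asterisque] Thm. 12.4, §17.13;
[Wuthrich2014] Cor. 18; [SteinWuthrich2013] Thm. 6.1; [Miller2011LMS] Def. 1.1; [SilvermanAEC2009]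
VII.1, VII.5.1; [Kraus1989]; [Cremona2006]; HOME/P3-EXCEPTIONAL-ZERO-ROAD.md §5/§8.
-/

set_option autoImplicit false

noncomputable section

open scoped Classical MatrixGroups ModularForm

open CongruenceSubgroup WeierstrassCurve Literature.NumberTheory.EllipticCurves
  Literature.NumberTheory.EllipticCurves.ModularForms
  Literature.NumberTheory.EllipticCurves.Rank1Residual
  Literature.NumberTheory.EllipticCurves.Rank1Residual.Typed
  Literature.NumberTheory.EllipticCurves.Rank1Residual.X11RankOneCertificates
  Literature.NumberTheory.EllipticCurves.Wuthrich2014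
  Literature.NumberTheory.EllipticCurves.SteinWuthrich2013
  Literature.NumberTheory.EllipticCurves.Greenberg1999
  Literature.NumberTheory.EllipticCurves.Kato2004
  Summit.BirchSwinnertonDyer.BirchSwinnertonDyer.Rank1Residual.IntModel
  Summit.BirchSwinnertonDyer.BirchSwinnertonDyer.Rank1Residual.X11RankOne
  Summit.BirchSwinnertonDyer.Rank1Residual.Supersingular
  Summit.BirchSwinnertonDyer.Rank1Residual.X11b
  Summit.BirchSwinnertonDyer.Rank1Residual.X11a.ChaRecords

namespace Summit.BirchSwinnertonDyer.Rank1Residual.X11a.UnitValueRecords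

/-! ### `118080de1 @ 5` (`N = 118080`, image `5Ns`, NON-split multiplicative at `5`, `∏ c_ℓ = 8`, `#Ш_an = 1`, `L(E,1)/Ω_E = 8` — a `5`-adic UNIT: the level-1 μ-witness) -/

/-- `118080de1 = [0, 0, 0, -759948, 256440272]` is globally minimal: `|Δ| = 2¹⁵ · 3³ · 5⁵ · 41⁵` (kernel) + Kraus.
[cite: SilvermanAEC2009, VII.1 Remark 1.1] [cite: Kraus1989, Prop. 1 and Prop. 2] -/
theorem isGloballyMinimal_u118080de1 : (⟨0, 0, 0, -759948, 256440272⟩ : WeierstrassCurve ℚ).IsGloballyMinimal :=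
  isGloballyMinimal_of_krausCriterion₃_factored 0 0 0 (-759948) 256440272
    [(2, 15), (3, 3), (5, 5), (41, 5)] (by decide +kernel)
    (by intro qe hqe; simp only [List.mem_cons, List.not_mem_nil, or_false] at hqe
        rcases hqe with rfl | rfl | rfl | rfl <;> norm_num)
    (by intro qe hqe; simp only [List.mem_cons, List.not_mem_nil, or_false] at hqe
        rcases hqe with rfl | rfl | rfl | rfl
        · exact Or.inr (Or.inr (Or.inl ⟨rfl, by decide +kernel, by decide +kernel⟩))
        · exact Or.inl (by decide +kernel)
        · exact Or.inl (by decide +kernel)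
        · exact Or.inl (by decide +kernel))

/-- `#Ẽ(𝔽_7) = 3` for `118080de1` (`a_7 = 5`; `X² − a_7X + 7` root-free mod `5`: the Frobenius
irreducibility witness, kernel count `countPoints`). [folklore] -/
theorem card_u118080de1_7 :
    Nat.card (((⟨0, 0, 0, -759948, 256440272⟩ : WeierstrassCurve ℤ).map (Int.castRingHom (ZMod 7))).toAffine.Point) = 3 := by
  have h := X11b.natCard_point_eq_countPoints 0 0 0 (-759948) 256440272 7 (by norm_num) (by decide +kernel)
  have h' : countPoints [0, 0, 0, -759948, 256440272] 7 = 3 := by decide +kernel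
  exact_mod_cast h.trans h'

/-- The node-tangent quadratic of `118080de1` mod `5` is root-free: NON-split multiplicative reduction at `5`
(kernel decision; Silverman *AEC* VII.5.1(b)). [cite: SilvermanAEC2009, VII.5 Prop. 5.1(b)] -/
theorem nodal_u118080de1 :
    letI E₀ : WeierstrassCurve ℤ := ⟨0, 0, 0, -759948, 256440272⟩
    ∀ t : ZMod 5, (E₀.c₄ : ZMod 5) * t ^ 2 + (E₀.a₁ * E₀.c₄ : ZMod 5) * t
      - (54 * E₀.b₆ - 3 * E₀.b₂ * E₀.b₄ + E₀.a₂ * E₀.c₄ : ZMod 5) ≠ 0 := by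
  decide +kernel

/-- **`118080de1 @ 5`: the UPPER half `ord₅ #Ш ≤ ord₅ #Ш_an`** (`Typed.MissingUpperBoundAt W 5` = crux `X11aNonSurjEulerHalf` / child
`UpperNonSurjFive` AT THIS PAIR) from the p3 road's UNIT-VALUE door (`X11a.ChaRecords.mub_of_unitValue_nonsplit`, p3 g1): NON-split
at `5` (kernel: node tangent `nodal_u118080de1`) and `L(E,1)/Ω_E = 8` a `5`-adic unit (DISPLAYED `ht`/`hunit` — the LEVEL-1 μ-witness: the
constant term `2·ϖ·[0]⁺_f = 2t` of the non-split Mazur–Tate–Teitelbaum function is a unit) ⟹ analytic μ = 0 ⟹ μ-transfer without big image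
⟹ Kato's integral divisibility ⟹ rank-0 engine; modulo the THIRTEEN named facts of `Theorems.x11aNonSurjEulerHalf_of_katoFacts_of_muAn` and
Greenberg–Stevens (vacuous at a non-split prime: `RankZeroHeightFree.greenberg_stevens_of_not_split`). DISPLAYED `r_an = 0` (`hr`), image bit `¬Surj`
(`hnsj`, `5Ns`). KERNEL: minimality, `Mult`, `Irr` (`card_u118080de1_7`), non-split. PER PAIR; nothing booked. [cite: MazurTateTeitelbaum1986Invent, §I.10]
[cite: Kato2004Asterisque, §17.13 (pp. 279–280)] [cite: Wuthrich2014, Cor. 18 (p. 398)] [cite: Cremona2006, Table 1 (Cremona label 118080de1)] -/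
theorem mub5_u118080de1
    (hJs : thm61_splitMultiplicative) (hJn : thm61_nonsplitMultiplicative)
    (hGZK : rank_eq_analyticRank_of_analyticRank_le_one) (hmod : hasEntireLFunction_rat)
    (hpar : nonempty_modularParametrizationData) (hne : Kato2004.nonempty_iwasawaH1Data) (h12 : Kato2004.thm12_4)
    (hns : Kato2004.exists_multDivisibilityInputs_nonsplit) (hsp : Kato2004.exists_multDivisibilityInputs_split)
    (h15 : thm15_isTorsion_multiplicative_rat)
    (h18 : Wuthrich2014.corollary18_padicLFunction_mem_iwasawaAlgebra_multiplicative)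
    (hfine : Kato2004.exists_multDivisibilityInputs_fine)
    (W : WeierstrassCurve ℚ) (hW : W = ⟨0, 0, 0, -759948, 256440272⟩)
    (hr : W.analyticRank = 0) (hnsj : ∀ [Fact (Nat.Prime 5)], ¬ Surj W 5)
    (ht : W.entireLFunction 1 / (W.realPeriodRat : ℂ) = ((8 : ℚ) : ℂ)) :
    MissingUpperBoundAt W 5 := by
  haveI : W.IsElliptic := by rw [hW]; exact X11b.isElliptic_of_discOf_ne_zero 0 0 0 (-759948) 256440272 (by decide +kernel)
  haveI : W.IsGloballyMinimal := by rw [hW]; exact isGloballyMinimal_u118080de1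
  haveI : Fact (Nat.Prime 5) := ⟨by norm_num⟩
  haveI : Fact (Nat.Prime 7) := ⟨by norm_num⟩
  have hI' : integralModelInt W = ⟨0, 0, 0, -759948, 256440272⟩ := by
    subst hW; exact integralModelInt_eq_of_map_eq _ (map_mk_int 0 0 0 (-759948) 256440272)
  have hmult : Mult W 5 :=
    hasMultiplicativeReductionAtPrime_of_intModel hI' 5 (by decide +kernel) (by decide +kernel)
  have hirr : Irr W 5 :=
    hasIrreducibleModPGaloisRep_of_intModel_of_noroot (hp := ⟨by norm_num⟩) (hℓ := ⟨by norm_num⟩)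
      hI' 5 7 (by norm_num) (by decide +kernel) card_u118080de1_7 (by decide)
  have hnsp : ¬ W.HasSplitMultiplicativeReductionAtPrime 5 :=
    not_hasSplitMultiplicativeReductionAtPrime_of_intModel_of_noroot hI' 5 (by decide +kernel)
      (by decide +kernel) nodal_u118080de1
  exact mub_of_unitValue_nonsplit hJs hJn hGZK hmod hpar hne h12 hns hsp h15 h18 hfine W 5 (RankZeroHeightFree.greenberg_stevens_of_not_split W 5 hnsp)
    (by decide) hr hmult hirr hnsj hnsp 8 ht
    (by rw [show (8 : ℚ) = ((8 : ℕ) : ℚ) by norm_num, padicValRat.of_nat]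
        exact_mod_cast padicValNat.eq_zero_of_not_dvd (by decide))

/-- **`BSD(E,5)` for `118080de1`** (`#Ш_an = 1`, a `5`-adic unit, displayed `hq`/`hv`; lower half free): `mub5_u118080de1` + GZK
(`X11a.bsdp_of_upper_of_unit_of_analyticRank_eq_zero`). PER PAIR (E1 currency); nothing booked. [cite: Miller2011LMS, §1 and Def. 1.1]
[cite: Cremona2006, Table 1 (Cremona label 118080de1)] -/
theorem bsdp5_u118080de1
    (hJs : thm61_splitMultiplicative) (hJn : thm61_nonsplitMultiplicative)
    (hGZK : rank_eq_analyticRank_of_analyticRank_le_one) (hmod : hasEntireLFunction_rat)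
    (hpar : nonempty_modularParametrizationData) (hne : Kato2004.nonempty_iwasawaH1Data) (h12 : Kato2004.thm12_4)
    (hns : Kato2004.exists_multDivisibilityInputs_nonsplit) (hsp : Kato2004.exists_multDivisibilityInputs_split)
    (h15 : thm15_isTorsion_multiplicative_rat)
    (h18 : Wuthrich2014.corollary18_padicLFunction_mem_iwasawaAlgebra_multiplicative)
    (hfine : Kato2004.exists_multDivisibilityInputs_fine)
    (W : WeierstrassCurve ℚ) (hW : W = ⟨0, 0, 0, -759948, 256440272⟩)
    (hr : W.analyticRank = 0) (hnsj : ∀ [Fact (Nat.Prime 5)], ¬ Surj W 5)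
    (ht : W.entireLFunction 1 / (W.realPeriodRat : ℂ) = ((8 : ℚ) : ℂ))
    {q : ℚ} (hq : shaAn W = (q : ℂ)) (hv : padicValRat 5 q = 0) : BSDp W 5 := by
  haveI : W.IsElliptic := by rw [hW]; exact X11b.isElliptic_of_discOf_ne_zero 0 0 0 (-759948) 256440272 (by decide +kernel)
  haveI : Fact (Nat.Prime 5) := ⟨by norm_num⟩
  exact bsdp_of_upper_of_unit_of_analyticRank_eq_zero W 5 hGZK hr (mub5_u118080de1 hJs hJn hGZK hmod hpar hne h12 hns hsp h15 h18 hfine W hW hr hnsj ht) hq hv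

/-! ### `118080df1 @ 5` (`N = 118080`, image `5Ns`, NON-split multiplicative at `5`, `∏ c_ℓ = 4`, `#Ш_an = 1`, `L(E,1)/Ω_E = 4` — a `5`-adic UNIT: the level-1 μ-witness) -/

/-- `118080df1 = [0, 0, 0, -759948, -256440272]` is globally minimal: `|Δ| = 2¹⁵ · 3³ · 5⁵ · 41⁵` (kernel) + Kraus.
[cite: SilvermanAEC2009, VII.1 Remark 1.1] [cite: Kraus1989, Prop. 1 and Prop. 2] -/
theorem isGloballyMinimal_u118080df1 : (⟨0, 0, 0, -759948, -256440272⟩ : WeierstrassCurve ℚ).IsGloballyMinimal :=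
  isGloballyMinimal_of_krausCriterion₃_factored 0 0 0 (-759948) (-256440272)
    [(2, 15), (3, 3), (5, 5), (41, 5)] (by decide +kernel)
    (by intro qe hqe; simp only [List.mem_cons, List.not_mem_nil, or_false] at hqe
        rcases hqe with rfl | rfl | rfl | rfl <;> norm_num)
    (by intro qe hqe; simp only [List.mem_cons, List.not_mem_nil, or_false] at hqe
        rcases hqe with rfl | rfl | rfl | rfl
        · exact Or.inr (Or.inr (Or.inl ⟨rfl, by decide +kernel, by decide +kernel⟩))
        · exact Or.inl (by decide +kernel)
        · exact Or.inl (by decide +kernel)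
        · exact Or.inl (by decide +kernel))

/-- `#Ẽ(𝔽_7) = 13` for `118080df1` (`a_7 = -5`; `X² − a_7X + 7` root-free mod `5`: the Frobenius
irreducibility witness, kernel count `countPoints`). [folklore] -/
theorem card_u118080df1_7 :
    Nat.card (((⟨0, 0, 0, -759948, -256440272⟩ : WeierstrassCurve ℤ).map (Int.castRingHom (ZMod 7))).toAffine.Point) = 13 := by
  have h := X11b.natCard_point_eq_countPoints 0 0 0 (-759948) (-256440272) 7 (by norm_num) (by decide +kernel)
  have h' : countPoints [0, 0, 0, -759948, -256440272] 7 = 13 := by decide +kernel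
  exact_mod_cast h.trans h'

/-- The node-tangent quadratic of `118080df1` mod `5` is root-free: NON-split multiplicative reduction at `5`
(kernel decision; Silverman *AEC* VII.5.1(b)). [cite: SilvermanAEC2009, VII.5 Prop. 5.1(b)] -/
theorem nodal_u118080df1 :
    letI E₀ : WeierstrassCurve ℤ := ⟨0, 0, 0, -759948, -256440272⟩
    ∀ t : ZMod 5, (E₀.c₄ : ZMod 5) * t ^ 2 + (E₀.a₁ * E₀.c₄ : ZMod 5) * t
      - (54 * E₀.b₆ - 3 * E₀.b₂ * E₀.b₄ + E₀.a₂ * E₀.c₄ : ZMod 5) ≠ 0 := by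
  decide +kernel

/-- **`118080df1 @ 5`: the UPPER half `ord₅ #Ш ≤ ord₅ #Ш_an`** (`Typed.MissingUpperBoundAt W 5` = crux `X11aNonSurjEulerHalf` / child
`UpperNonSurjFive` AT THIS PAIR) from the p3 road's UNIT-VALUE door (`X11a.ChaRecords.mub_of_unitValue_nonsplit`, p3 g1): NON-split
at `5` (kernel: node tangent `nodal_u118080df1`) and `L(E,1)/Ω_E = 4` a `5`-adic unit (DISPLAYED `ht`/`hunit` — the LEVEL-1 μ-witness: the
constant term `2·ϖ·[0]⁺_f = 2t` of the non-split Mazur–Tate–Teitelbaum function is a unit) ⟹ analytic μ = 0 ⟹ μ-transfer without big image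
⟹ Kato's integral divisibility ⟹ rank-0 engine; modulo the THIRTEEN named facts of `Theorems.x11aNonSurjEulerHalf_of_katoFacts_of_muAn` and
Greenberg–Stevens (vacuous at a non-split prime: `RankZeroHeightFree.greenberg_stevens_of_not_split`). DISPLAYED `r_an = 0` (`hr`), image bit `¬Surj`
(`hnsj`, `5Ns`). KERNEL: minimality, `Mult`, `Irr` (`card_u118080df1_7`), non-split. PER PAIR; nothing booked. [cite: MazurTateTeitelbaum1986Invent, §I.10]
[cite: Kato2004Asterisque, §17.13 (pp. 279–280)] [cite: Wuthrich2014, Cor. 18 (p. 398)] [cite: Cremona2006, Table 1 (Cremona label 118080df1)] -/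
theorem mub5_u118080df1
    (hJs : thm61_splitMultiplicative) (hJn : thm61_nonsplitMultiplicative)
    (hGZK : rank_eq_analyticRank_of_analyticRank_le_one) (hmod : hasEntireLFunction_rat)
    (hpar : nonempty_modularParametrizationData) (hne : Kato2004.nonempty_iwasawaH1Data) (h12 : Kato2004.thm12_4)
    (hns : Kato2004.exists_multDivisibilityInputs_nonsplit) (hsp : Kato2004.exists_multDivisibilityInputs_split)
    (h15 : thm15_isTorsion_multiplicative_rat)
    (h18 : Wuthrich2014.corollary18_padicLFunction_mem_iwasawaAlgebra_multiplicative)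
    (hfine : Kato2004.exists_multDivisibilityInputs_fine)
    (W : WeierstrassCurve ℚ) (hW : W = ⟨0, 0, 0, -759948, -256440272⟩)
    (hr : W.analyticRank = 0) (hnsj : ∀ [Fact (Nat.Prime 5)], ¬ Surj W 5)
    (ht : W.entireLFunction 1 / (W.realPeriodRat : ℂ) = ((4 : ℚ) : ℂ)) :
    MissingUpperBoundAt W 5 := by
  haveI : W.IsElliptic := by rw [hW]; exact X11b.isElliptic_of_discOf_ne_zero 0 0 0 (-759948) (-256440272) (by decide +kernel)
  haveI : W.IsGloballyMinimal := by rw [hW]; exact isGloballyMinimal_u118080df1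
  haveI : Fact (Nat.Prime 5) := ⟨by norm_num⟩
  haveI : Fact (Nat.Prime 7) := ⟨by norm_num⟩
  have hI' : integralModelInt W = ⟨0, 0, 0, -759948, -256440272⟩ := by
    subst hW; exact integralModelInt_eq_of_map_eq _ (map_mk_int 0 0 0 (-759948) (-256440272))
  have hmult : Mult W 5 :=
    hasMultiplicativeReductionAtPrime_of_intModel hI' 5 (by decide +kernel) (by decide +kernel)
  have hirr : Irr W 5 :=
    hasIrreducibleModPGaloisRep_of_intModel_of_noroot (hp := ⟨by norm_num⟩) (hℓ := ⟨by norm_num⟩)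
      hI' 5 7 (by norm_num) (by decide +kernel) card_u118080df1_7 (by decide)
  have hnsp : ¬ W.HasSplitMultiplicativeReductionAtPrime 5 :=
    not_hasSplitMultiplicativeReductionAtPrime_of_intModel_of_noroot hI' 5 (by decide +kernel)
      (by decide +kernel) nodal_u118080df1
  exact mub_of_unitValue_nonsplit hJs hJn hGZK hmod hpar hne h12 hns hsp h15 h18 hfine W 5 (RankZeroHeightFree.greenberg_stevens_of_not_split W 5 hnsp)
    (by decide) hr hmult hirr hnsj hnsp 4 ht
    (by rw [show (4 : ℚ) = ((4 : ℕ) : ℚ) by norm_num, padicValRat.of_nat]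
        exact_mod_cast padicValNat.eq_zero_of_not_dvd (by decide))

/-- **`BSD(E,5)` for `118080df1`** (`#Ш_an = 1`, a `5`-adic unit, displayed `hq`/`hv`; lower half free): `mub5_u118080df1` + GZK
(`X11a.bsdp_of_upper_of_unit_of_analyticRank_eq_zero`). PER PAIR (E1 currency); nothing booked. [cite: Miller2011LMS, §1 and Def. 1.1]
[cite: Cremona2006, Table 1 (Cremona label 118080df1)] -/
theorem bsdp5_u118080df1
    (hJs : thm61_splitMultiplicative) (hJn : thm61_nonsplitMultiplicative)
    (hGZK : rank_eq_analyticRank_of_analyticRank_le_one) (hmod : hasEntireLFunction_rat)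
    (hpar : nonempty_modularParametrizationData) (hne : Kato2004.nonempty_iwasawaH1Data) (h12 : Kato2004.thm12_4)
    (hns : Kato2004.exists_multDivisibilityInputs_nonsplit) (hsp : Kato2004.exists_multDivisibilityInputs_split)
    (h15 : thm15_isTorsion_multiplicative_rat)
    (h18 : Wuthrich2014.corollary18_padicLFunction_mem_iwasawaAlgebra_multiplicative)
    (hfine : Kato2004.exists_multDivisibilityInputs_fine)
    (W : WeierstrassCurve ℚ) (hW : W = ⟨0, 0, 0, -759948, -256440272⟩)
    (hr : W.analyticRank = 0) (hnsj : ∀ [Fact (Nat.Prime 5)], ¬ Surj W 5)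
    (ht : W.entireLFunction 1 / (W.realPeriodRat : ℂ) = ((4 : ℚ) : ℂ))
    {q : ℚ} (hq : shaAn W = (q : ℂ)) (hv : padicValRat 5 q = 0) : BSDp W 5 := by
  haveI : W.IsElliptic := by rw [hW]; exact X11b.isElliptic_of_discOf_ne_zero 0 0 0 (-759948) (-256440272) (by decide +kernel)
  haveI : Fact (Nat.Prime 5) := ⟨by norm_num⟩
  exact bsdp_of_upper_of_unit_of_analyticRank_eq_zero W 5 hGZK hr (mub5_u118080df1 hJs hJn hGZK hmod hpar hne h12 hns hsp h15 h18 hfine W hW hr hnsj ht) hq hv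

/-! ### `154880h1 @ 5` (`N = 154880`, image `5Ns`, NON-split multiplicative at `5`, `∏ c_ℓ = 4`, `#Ш_an = 1`, `L(E,1)/Ω_E = 4` — a `5`-adic UNIT: the level-1 μ-witness) -/

/-- `154880h1 = [0, -1, 0, -1266701, -548308715]` is globally minimal: `|Δ| = 2¹⁵ · 5⁵ · 11³` (kernel) + Kraus.
[cite: SilvermanAEC2009, VII.1 Remark 1.1] [cite: Kraus1989, Prop. 1 and Prop. 2] -/
theorem isGloballyMinimal_u154880h1 : (⟨0, -1, 0, -1266701, -548308715⟩ : WeierstrassCurve ℚ).IsGloballyMinimal :=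
  isGloballyMinimal_of_krausCriterion₃_factored 0 (-1) 0 (-1266701) (-548308715)
    [(2, 15), (5, 5), (11, 3)] (by decide +kernel)
    (by intro qe hqe; simp only [List.mem_cons, List.not_mem_nil, or_false] at hqe
        rcases hqe with rfl | rfl | rfl <;> norm_num)
    (by intro qe hqe; simp only [List.mem_cons, List.not_mem_nil, or_false] at hqe
        rcases hqe with rfl | rfl | rfl
        · exact Or.inr (Or.inr (Or.inl ⟨rfl, by decide +kernel, by decide +kernel⟩))
        · exact Or.inl (by decide +kernel)
        · exact Or.inl (by decide +kernel))

/-- `#Ẽ(𝔽_7) = 13` for `154880h1` (`a_7 = -5`; `X² − a_7X + 7` root-free mod `5`: the Frobenius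
irreducibility witness, kernel count `countPoints`). [folklore] -/
theorem card_u154880h1_7 :
    Nat.card (((⟨0, -1, 0, -1266701, -548308715⟩ : WeierstrassCurve ℤ).map (Int.castRingHom (ZMod 7))).toAffine.Point) = 13 := by
  have h := X11b.natCard_point_eq_countPoints 0 (-1) 0 (-1266701) (-548308715) 7 (by norm_num) (by decide +kernel)
  have h' : countPoints [0, -1, 0, -1266701, -548308715] 7 = 13 := by decide +kernel
  exact_mod_cast h.trans h'

/-- The node-tangent quadratic of `154880h1` mod `5` is root-free: NON-split multiplicative reduction at `5`
(kernel decision; Silverman *AEC* VII.5.1(b)). [cite: SilvermanAEC2009, VII.5 Prop. 5.1(b)] -/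
theorem nodal_u154880h1 :
    letI E₀ : WeierstrassCurve ℤ := ⟨0, -1, 0, -1266701, -548308715⟩
    ∀ t : ZMod 5, (E₀.c₄ : ZMod 5) * t ^ 2 + (E₀.a₁ * E₀.c₄ : ZMod 5) * t
      - (54 * E₀.b₆ - 3 * E₀.b₂ * E₀.b₄ + E₀.a₂ * E₀.c₄ : ZMod 5) ≠ 0 := by
  decide +kernel

/-- **`154880h1 @ 5`: the UPPER half `ord₅ #Ш ≤ ord₅ #Ш_an`** (`Typed.MissingUpperBoundAt W 5` = crux `X11aNonSurjEulerHalf` / child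
`UpperNonSurjFive` AT THIS PAIR) from the p3 road's UNIT-VALUE door (`X11a.ChaRecords.mub_of_unitValue_nonsplit`, p3 g1): NON-split
at `5` (kernel: node tangent `nodal_u154880h1`) and `L(E,1)/Ω_E = 4` a `5`-adic unit (DISPLAYED `ht`/`hunit` — the LEVEL-1 μ-witness: the
constant term `2·ϖ·[0]⁺_f = 2t` of the non-split Mazur–Tate–Teitelbaum function is a unit) ⟹ analytic μ = 0 ⟹ μ-transfer without big image
⟹ Kato's integral divisibility ⟹ rank-0 engine; modulo the THIRTEEN named facts of `Theorems.x11aNonSurjEulerHalf_of_katoFacts_of_muAn` and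
Greenberg–Stevens (vacuous at a non-split prime: `RankZeroHeightFree.greenberg_stevens_of_not_split`). DISPLAYED `r_an = 0` (`hr`), image bit `¬Surj`
(`hnsj`, `5Ns`). KERNEL: minimality, `Mult`, `Irr` (`card_u154880h1_7`), non-split. PER PAIR; nothing booked. [cite: MazurTateTeitelbaum1986Invent, §I.10]
[cite: Kato2004Asterisque, §17.13 (pp. 279–280)] [cite: Wuthrich2014, Cor. 18 (p. 398)] [cite: Cremona2006, Table 1 (Cremona label 154880h1)] -/
theorem mub5_u154880h1
    (hJs : thm61_splitMultiplicative) (hJn : thm61_nonsplitMultiplicative)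
    (hGZK : rank_eq_analyticRank_of_analyticRank_le_one) (hmod : hasEntireLFunction_rat)
    (hpar : nonempty_modularParametrizationData) (hne : Kato2004.nonempty_iwasawaH1Data) (h12 : Kato2004.thm12_4)
    (hns : Kato2004.exists_multDivisibilityInputs_nonsplit) (hsp : Kato2004.exists_multDivisibilityInputs_split)
    (h15 : thm15_isTorsion_multiplicative_rat)
    (h18 : Wuthrich2014.corollary18_padicLFunction_mem_iwasawaAlgebra_multiplicative)
    (hfine : Kato2004.exists_multDivisibilityInputs_fine)
    (W : WeierstrassCurve ℚ) (hW : W = ⟨0, -1, 0, -1266701, -548308715⟩)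
    (hr : W.analyticRank = 0) (hnsj : ∀ [Fact (Nat.Prime 5)], ¬ Surj W 5)
    (ht : W.entireLFunction 1 / (W.realPeriodRat : ℂ) = ((4 : ℚ) : ℂ)) :
    MissingUpperBoundAt W 5 := by
  haveI : W.IsElliptic := by rw [hW]; exact X11b.isElliptic_of_discOf_ne_zero 0 (-1) 0 (-1266701) (-548308715) (by decide +kernel)
  haveI : W.IsGloballyMinimal := by rw [hW]; exact isGloballyMinimal_u154880h1
  haveI : Fact (Nat.Prime 5) := ⟨by norm_num⟩
  haveI : Fact (Nat.Prime 7) := ⟨by norm_num⟩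
  have hI' : integralModelInt W = ⟨0, -1, 0, -1266701, -548308715⟩ := by
    subst hW; exact integralModelInt_eq_of_map_eq _ (map_mk_int 0 (-1) 0 (-1266701) (-548308715))
  have hmult : Mult W 5 :=
    hasMultiplicativeReductionAtPrime_of_intModel hI' 5 (by decide +kernel) (by decide +kernel)
  have hirr : Irr W 5 :=
    hasIrreducibleModPGaloisRep_of_intModel_of_noroot (hp := ⟨by norm_num⟩) (hℓ := ⟨by norm_num⟩)
      hI' 5 7 (by norm_num) (by decide +kernel) card_u154880h1_7 (by decide)
  have hnsp : ¬ W.HasSplitMultiplicativeReductionAtPrime 5 :=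
    not_hasSplitMultiplicativeReductionAtPrime_of_intModel_of_noroot hI' 5 (by decide +kernel)
      (by decide +kernel) nodal_u154880h1
  exact mub_of_unitValue_nonsplit hJs hJn hGZK hmod hpar hne h12 hns hsp h15 h18 hfine W 5 (RankZeroHeightFree.greenberg_stevens_of_not_split W 5 hnsp)
    (by decide) hr hmult hirr hnsj hnsp 4 ht
    (by rw [show (4 : ℚ) = ((4 : ℕ) : ℚ) by norm_num, padicValRat.of_nat]
        exact_mod_cast padicValNat.eq_zero_of_not_dvd (by decide))

/-- **`BSD(E,5)` for `154880h1`** (`#Ш_an = 1`, a `5`-adic unit, displayed `hq`/`hv`; lower half free): `mub5_u154880h1` + GZK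
(`X11a.bsdp_of_upper_of_unit_of_analyticRank_eq_zero`). PER PAIR (E1 currency); nothing booked. [cite: Miller2011LMS, §1 and Def. 1.1]
[cite: Cremona2006, Table 1 (Cremona label 154880h1)] -/
theorem bsdp5_u154880h1
    (hJs : thm61_splitMultiplicative) (hJn : thm61_nonsplitMultiplicative)
    (hGZK : rank_eq_analyticRank_of_analyticRank_le_one) (hmod : hasEntireLFunction_rat)
    (hpar : nonempty_modularParametrizationData) (hne : Kato2004.nonempty_iwasawaH1Data) (h12 : Kato2004.thm12_4)
    (hns : Kato2004.exists_multDivisibilityInputs_nonsplit) (hsp : Kato2004.exists_multDivisibilityInputs_split)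
    (h15 : thm15_isTorsion_multiplicative_rat)
    (h18 : Wuthrich2014.corollary18_padicLFunction_mem_iwasawaAlgebra_multiplicative)
    (hfine : Kato2004.exists_multDivisibilityInputs_fine)
    (W : WeierstrassCurve ℚ) (hW : W = ⟨0, -1, 0, -1266701, -548308715⟩)
    (hr : W.analyticRank = 0) (hnsj : ∀ [Fact (Nat.Prime 5)], ¬ Surj W 5)
    (ht : W.entireLFunction 1 / (W.realPeriodRat : ℂ) = ((4 : ℚ) : ℂ))
    {q : ℚ} (hq : shaAn W = (q : ℂ)) (hv : padicValRat 5 q = 0) : BSDp W 5 := by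
  haveI : W.IsElliptic := by rw [hW]; exact X11b.isElliptic_of_discOf_ne_zero 0 (-1) 0 (-1266701) (-548308715) (by decide +kernel)
  haveI : Fact (Nat.Prime 5) := ⟨by norm_num⟩
  exact bsdp_of_upper_of_unit_of_analyticRank_eq_zero W 5 hGZK hr (mub5_u154880h1 hJs hJn hGZK hmod hpar hne h12 hns hsp h15 h18 hfine W hW hr hnsj ht) hq hv

end Summit.BirchSwinnertonDyer.Rank1Residual.X11a.UnitValueRecords

end
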